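/- Copyright: the b2b-balaban cell (near-miss cell 7), T⁴-continuum fan-out, lineage t4-ne7b-p1 (node U5c COUNT
member).  Released under the licence of the surrounding project. -/
import Summits.QuantumFields.BalabanUV.T4Continuum.Support.HistoryBankingPedigreeMax

/-!
# M5-1b (A3b) — THE FLAT LEDGER ALONG A PEDIGREE: components, young volume, dead anchors, and the PER-STEP INEQUALITY
`V(m) ≤ Y(m) + 561^d·(Σ_{components at t} 2^d·(16·21^d·V_x(t)∕2^{m−t} + 1) + #recent births)` (owner module of row NE7b,
lineage `t4-ne7b-p1` gen 43; re-open object (α), `SCOPE-alpha.md` v2.6, ruling R-OWNER-43-1 «THE FLAT ANCHOR LEDGER»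
(c); PRE-POSITIONING ONLY)

Summits-side support leaf of the T⁴-continuum cell (rung (B)+1 on a FINITE torus only; NOT infinite volume, NOT the
mass gap, NOT the Clay statement; NOT a proof of the spine estimate NE7b — the cell's OWN estimate, NOT PRINTED, NOT
PROVED).  [folklore] finite combinatorics on `ℤᵈ` and real arithmetic over `HistoryAdmissible.PGen` ∕
`HistoryRealiseWeak.RealisesW`, A3a `HistoryBankingPedigreeMax.MDP`, A1 `HistoryBankingAnchors` (b02's `B16OverhangN`
underneath) and `HistoryRealiseCells.anchorAt`; nothing printed is asserted, no `def … : Prop` fact of Bałaban's, no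
cite-tagged hypothesis, zero `sorry`.  Five `def`s (`compSum`, `youngVol`, `youngSet`, `deadAnchors`, `recent`) are
recursive finite sums ∕ sets over the pedigree.  B16 = [Balaban1989LargeFieldII] pp. 384–387 under audit; locators only.

WHY (ruling R-OWNER-43-1 (c), journal «RULING R-OWNER-43-1»).  The flat ledger forms no per-component budget: at each
step `m` the structure's maximal volume `V(m) = Σ_{components x at m} #MDP_x(m)` is read as YOUNG birth images plus
`561^d` per distinct ANCHOR of a dead birth, and the anchors at scale `m` are coarse images of cubes of the components'
maximal domains at the lag time `t` — one decaying footprint term per component alive at `t`, plus one anchor per birth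
after `t`.  THIS FILE types that sentence along the pedigree by structural recursion (a renewal is transparent; a join is
one component from its step on, the pair of its partners' families before): §1 `compSum` (`V = compSum id`, `N = compSum
1`; one component from `lastStep` on); §2 `youngVol` ∕ `youngSet` ∕ `deadAnchors` ∕ `recent` and the COVER
`MDP P m ⊆ youngSet P m ∪ ⋃_{a ∈ deadAnchors P m} box a 280` (A1's box lemma; the anchor cube is the tag's `zZ.1 ∈ zZ.2`),
whence `#MDP P m ≤ youngVol P m + 561^d·#deadAnchors P m`; §3 ANCHOR TRANSPORT `deadAnchors P m ⊆ closureIdx (Qfrom L s t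
(m−t)) (MDP P t)` for `t ≥ lastStep` and the lagged count `#deadAnchors P m ≤ compSum foot P t + recent P t m` (A1's decay on
each component at `t`, non-empty and touch-connected by A3a); §4 **`perStep`** — the inequality of the title, the shape of
`HistoryBankingFlatLedger.flat_total_le`'s hypothesis.

WHAT IS *NOT* DONE HERE.  A3c (the END side: young volume of each birth against its bookings — `HistoryBankingYoungBirth`;
one performed floor per component-step via `Gen.covers`; the fee per birth; the lagged sum by A2; the reading display) and
M5-2 (the witness's `κ` in volume form).  HONEST: index-model bookkeeping; NE7b NOT proved; spine 0∕9.  HONEST DEPENDENCY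
(cell): continuum YM on T⁴ ⇐ BetaPertH ∧ nine spine estimates (0∕9 proved); BetaPertH ⇐ (D1) ∧ (D4) ∧ CAP+tail.
-/

open Finset
open Literature.MathematicalPhysics.QuantumFieldTheory.Balaban1983to89
open Literature.MathematicalPhysics.QuantumFieldTheory.Balaban1983to89.B13ScaleTransfer
open Literature.MathematicalPhysics.QuantumFieldTheory.Balaban1983to89.TreeLength
open Literature.MathematicalPhysics.QuantumFieldTheory.Balaban1983to89.B16SProfile
open Literature.MathematicalPhysics.QuantumFieldTheory.Balaban1983to89.B16MergeGeometry
open Literature.MathematicalPhysics.QuantumFieldTheory.Balaban1983to89.B16StoppingRule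
open Literature.MathematicalPhysics.QuantumFieldTheory.Balaban1983to89.B16MergeHorizon
open Literature.MathematicalPhysics.QuantumFieldTheory.Balaban1983to89.B16OverhangN
open Summit.QuantumFields.BalabanUV.T4Continuum.HistoryAdmissible
open Summit.QuantumFields.BalabanUV.T4Continuum.HistoryRealise
open Summit.QuantumFields.BalabanUV.T4Continuum.HistoryRealiseCells
open Summit.QuantumFields.BalabanUV.T4Continuum.HistoryRealiseWeak
open Summit.QuantumFields.BalabanUV.T4Continuum.HistoryBankingAnchors
open Summit.QuantumFields.BalabanUV.T4Continuum.HistoryBankingPedigreeMax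

namespace Summit.QuantumFields.BalabanUV.T4Continuum.HistoryBankingPedigreeLedger

noncomputable section

open scoped Classical

variable {d : ℕ}

/-! ## §1 Component sums along the pedigree -/

section Components

variable (L : ℕ) (s : ℕ → ℕ)

/-- **THE COMPONENT SUM AT TIME `t`**: `Σ φ(#MDP_x(t))` over the components `x` of the structure at time `t` — a birth is
a component once born; a renewal is transparent; a join is ONE component from its step on (volume of the union) and
the pair of its partners' component families before. [folklore] -/
def compSum (φ : ℕ → ℝ) : PGen (Pt d × Finset (Pt d)) → ℕ → ℝ
  | .birth j cls zZ, t => if j ≤ t then φ (MDP L s (.birth j cls zZ) t).card else 0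
  | .renew G _, t => compSum φ G t
  | .join X Y sj, t => if sj ≤ t then φ (MDP L s (.join X Y sj) t).card else compSum φ X t + compSum φ Y t

variable {L s}

/-- a component sum of a nonnegative function is nonnegative [folklore] -/
theorem compSum_nonneg {φ : ℕ → ℝ} (hφ : ∀ v, 0 ≤ φ v) : ∀ (P : PGen (Pt d × Finset (Pt d))) (t : ℕ),
    0 ≤ compSum L s φ P t
  | .birth j _ _, t => by unfold compSum; split_ifs <;> simp [hφ]
  | .renew G _, t => compSum_nonneg hφ G t
  | .join X Y sj, t => by
      unfold compSum; split_ifs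
      exacts [hφ _, add_nonneg (compSum_nonneg hφ X t) (compSum_nonneg hφ Y t)]

/-- **ONE COMPONENT FROM THE LAST EVENT ON**: for `t ≥ lastStep` (under `Adm`), `compSum φ P t = φ (#MDP P t)`.
[folklore] -/
theorem compSum_of_le {φ : ℕ → ℝ} : ∀ (P : PGen (Pt d × Finset (Pt d))) {K t : ℕ}, P.Adm K → P.lastStep ≤ t →
    compSum L s φ P t = φ (MDP L s P t).card
  | .birth j _ _, K, t, _, ht => by simp only [PGen.lastStep] at ht; unfold compSum; rw [if_pos ht]
  | .renew G h, K, t, hA, ht => by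
      simp only [PGen.Adm] at hA; simp only [PGen.lastStep] at ht
      unfold compSum; rw [MDP_renew]; exact compSum_of_le G hA.1 (by omega)
  | .join X Y sj, K, t, _, ht => by simp only [PGen.lastStep] at ht; unfold compSum; rw [if_pos ht]

end Components

/-! ## §2 The young ∕ dead split of the births, and the cover of the maximal domain -/

section Split

variable (L : ℕ) (s : ℕ → ℕ)

/-- **THE YOUNG VOLUME AT `m`**: the images of the births that have happened and whose OWN orbit has not met condition
(i) at any index up to `m`. [folklore] -/
def youngVol : PGen (Pt d × Finset (Pt d)) → ℕ → ℝ
  | .birth j _ zZ, m =>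
      if j ≤ m ∧ ∀ i, i ≤ m - j → ¬ CondI 100 (orbit L s j zZ.2 i) then ((orbit L s j zZ.2 (m - j)).card : ℝ) else 0
  | .renew G _, m => youngVol G m
  | .join X Y _, m => youngVol X m + youngVol Y m

/-- the young images as a set [folklore] -/
def youngSet : PGen (Pt d × Finset (Pt d)) → ℕ → Finset (Pt d)
  | .birth j _ zZ, m =>
      if j ≤ m ∧ ∀ i, i ≤ m - j → ¬ CondI 100 (orbit L s j zZ.2 i) then orbit L s j zZ.2 (m - j) else ∅
  | .renew G _, m => youngSet G m
  | .join X Y _, m => youngSet X m ∪ youngSet Y m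

/-- **THE DEAD ANCHORS AT `m`**: the re-blocked anchors `anchorAt · m` of the births that have happened and whose orbit
has met condition (i) by `m` (coalesced anchors count once). [folklore] -/
def deadAnchors : PGen (Pt d × Finset (Pt d)) → ℕ → Finset (Pt d)
  | .birth j cls zZ, m =>
      if j ≤ m ∧ ∃ i, i ≤ m - j ∧ CondI 100 (orbit L s j zZ.2 i) then {anchorAt L s (.birth j cls zZ) m} else ∅
  | .renew G _, m => deadAnchors G m
  | .join X Y _, m => deadAnchors X m ∪ deadAnchors Y m

variable {L s}

/-- **THE NUMBER OF BIRTHS AFTER `t` UP TO `m`** (the recent births of the lag). [folklore] -/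
def recent : PGen (Pt d × Finset (Pt d)) → ℕ → ℕ → ℕ
  | .birth j _ _, t, m => if t < j ∧ j ≤ m then 1 else 0
  | .renew G _, t, m => recent G t m
  | .join X Y _, t, m => recent X t m + recent Y t m

/-- a join's young volume is the partners' [folklore] -/
@[simp] theorem youngVol_join (X Y : PGen (Pt d × Finset (Pt d))) (sj m : ℕ) :
    youngVol L s (.join X Y sj) m = youngVol L s X m + youngVol L s Y m := rfl

/-- a join's young set is the partners' [folklore] -/
@[simp] theorem youngSet_join (X Y : PGen (Pt d × Finset (Pt d))) (sj m : ℕ) :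
    youngSet L s (.join X Y sj) m = youngSet L s X m ∪ youngSet L s Y m := rfl

/-- a join's dead anchors are the partners' [folklore] -/
@[simp] theorem deadAnchors_join (X Y : PGen (Pt d × Finset (Pt d))) (sj m : ℕ) :
    deadAnchors L s (.join X Y sj) m = deadAnchors L s X m ∪ deadAnchors L s Y m := rfl

/-- a join's recent births are the partners' [folklore] -/
@[simp] theorem recent_join (X Y : PGen (Pt d × Finset (Pt d))) (sj t m : ℕ) :
    recent (.join X Y sj) t m = recent X t m + recent Y t m := rfl

/-- the young volume is nonnegative [folklore] -/
theorem youngVol_nonneg : ∀ (P : PGen (Pt d × Finset (Pt d))) (m : ℕ), 0 ≤ youngVol L s P m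
  | .birth j _ _, m => by unfold youngVol; split_ifs <;> positivity
  | .renew G _, m => youngVol_nonneg G m
  | .join X Y _, m => add_nonneg (youngVol_nonneg X m) (youngVol_nonneg Y m)

/-- the young set has at most the young volume many cubes [folklore] -/
theorem card_youngSet_le : ∀ (P : PGen (Pt d × Finset (Pt d))) (m : ℕ),
    ((youngSet L s P m).card : ℝ) ≤ youngVol L s P m
  | .birth j _ _, m => by unfold youngSet youngVol; split_ifs <;> simp
  | .renew G _, m => card_youngSet_le G m
  | .join X Y _, m => by
      unfold youngSet youngVol
      have h := Finset.card_union_le (youngSet L s X m) (youngSet L s Y m)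
      have hX := card_youngSet_le X m; have hY := card_youngSet_le Y m
      have h' : ((youngSet L s X m ∪ youngSet L s Y m).card : ℝ) ≤ (youngSet L s X m).card + (youngSet L s Y m).card := by
        exact_mod_cast h
      linarith

/-- **THE COVER**: along a flow with `L ≥ 2` and drop control on every horizon, the maximal domain of a realised pedigree
at `m` lies in its young set and the radius-`280` boxes about its dead anchors (a dead birth's orbit stays in the box
about its anchor — A1's `orbit_subset_box_of_condI`, the anchor cube being the tag's `zZ.1 ∈ zZ.2`). [folklore] -/
theorem MDP_subset_young_union_boxes (hL : 2 ≤ L) (hdrop : ∀ m, DropCtl s m) {R : ℕ → ℕ} :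
    ∀ (P : PGen (Pt d × Finset (Pt d))) (Z : Finset (Pt d)), RealisesW L s R P Z → ∀ (m : ℕ),
      MDP L s P m ⊆ youngSet L s P m ∪ (deadAnchors L s P m).biUnion fun a => box a 280
  | .birth j cls zZ, Z, hP, m => by
      obtain ⟨hZ, hc, -, -⟩ := hP
      have hcZ : zZ.1 ∈ zZ.2 := by rw [hZ]; exact hc
      intro y hy
      unfold MDP at hy
      by_cases hj : j ≤ m
      · rw [if_pos hj] at hy
        rw [Finset.mem_union]
        by_cases hyoung : ∀ i, i ≤ m - j → ¬ CondI 100 (orbit L s j zZ.2 i)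
        · left; unfold youngSet; rw [if_pos ⟨hj, hyoung⟩]; exact hy
        · right
          push Not at hyoung
          obtain ⟨i, hi, hI⟩ := hyoung
          unfold deadAnchors
          rw [if_pos ⟨hj, i, hi, hI⟩, Finset.singleton_biUnion]
          exact orbit_subset_box_of_condI hL hdrop hcZ hI hi hy
      · rw [if_neg hj] at hy; simp at hy
  | .renew G h, Z, hP, m => by
      obtain ⟨ZG, hG, -⟩ := hP
      exact MDP_subset_young_union_boxes hL hdrop G ZG hG m
  | .join X Y sj, Z, hP, m => by
      obtain ⟨ZX, ZY, hX, hY, -⟩ := hP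
      have h1 := MDP_subset_young_union_boxes hL hdrop X ZX hX m
      have h2 := MDP_subset_young_union_boxes hL hdrop Y ZY hY m
      rw [MDP_join, youngSet_join, deadAnchors_join]
      intro y hy
      rw [Finset.mem_union]
      rcases Finset.mem_union.1 hy with hy | hy
      · rcases Finset.mem_union.1 (h1 hy) with h | h
        · exact Or.inl (Finset.mem_union.2 (Or.inl h))
        · obtain ⟨a, ha, hya⟩ := Finset.mem_biUnion.1 h
          exact Or.inr (Finset.mem_biUnion.2 ⟨a, Finset.mem_union.2 (Or.inl ha), hya⟩)
      · rcases Finset.mem_union.1 (h2 hy) with h | h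
        · exact Or.inl (Finset.mem_union.2 (Or.inr h))
        · obtain ⟨a, ha, hya⟩ := Finset.mem_biUnion.1 h
          exact Or.inr (Finset.mem_biUnion.2 ⟨a, Finset.mem_union.2 (Or.inr ha), hya⟩)

/-- **YOUNG IMAGES PLUS `561^d` PER DEAD ANCHOR**: `#MDP P m ≤ youngVol P m + 561^d·#deadAnchors P m`. [folklore] -/
theorem card_MDP_le_young_add_dead (hL : 2 ≤ L) (hdrop : ∀ m, DropCtl s m) {R : ℕ → ℕ}
    {P : PGen (Pt d × Finset (Pt d))} {Z : Finset (Pt d)} (hP : RealisesW L s R P Z) (m : ℕ) :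
    ((MDP L s P m).card : ℝ) ≤ youngVol L s P m + 561 ^ d * ((deadAnchors L s P m).card : ℝ) := by
  have h1 := Finset.card_le_card (MDP_subset_young_union_boxes hL hdrop P Z hP m)
  have h2 := Finset.card_union_le (youngSet L s P m) ((deadAnchors L s P m).biUnion fun a => box a 280)
  have h3 : ((deadAnchors L s P m).biUnion fun a => box a 280).card ≤ 561 ^ d * (deadAnchors L s P m).card := by
    refine Finset.card_biUnion_le.trans ?_
    rw [Finset.sum_const_nat (m := 561 ^ d) fun p _ => by norm_num [card_box], Nat.mul_comm]
  have h4 : ((MDP L s P m).card : ℝ) ≤ (youngSet L s P m).card + 561 ^ d * ((deadAnchors L s P m).card : ℝ) := by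
    exact_mod_cast h1.trans (h2.trans (Nat.add_le_add_left h3 _))
  linarith [card_youngSet_le (L := L) (s := s) P m]

end Split

/-! ## §3 Anchor transport along the pedigree and the lagged count of the dead anchors -/

section Transport

variable {L : ℕ} {s R : ℕ → ℕ}

/-- every birth is dated at or before the last event: a dead anchor comes from a birth at a step `≤ lastStep` (under
`Adm`), so there are none before the root and — the transport — for `lastStep ≤ t ≤ m` every dead anchor at scale `m`
lies in the footprint `closureIdx (Qfrom L s t (m − t)) (MDP P t)`. [folklore] -/
theorem deadAnchors_subset_closureIdx :
    ∀ (P : PGen (Pt d × Finset (Pt d))) (Z : Finset (Pt d)), RealisesW L s R P Z → ∀ {t m : ℕ},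
      P.lastStep ≤ t → t ≤ m → deadAnchors L s P m ⊆ closureIdx (Qfrom L s t (m - t)) (MDP L s P t)
  | .birth j cls zZ, Z, hP, t, m, ht, htm => by
      obtain ⟨hZ, hc, -, -⟩ := hP
      simp only [PGen.lastStep] at ht
      unfold deadAnchors
      split_ifs
      · intro a ha
        rw [Finset.mem_singleton] at ha
        rw [ha, MDP_birth_of_le ht, ← coarse_anchorAt L s (PGen.birth j cls zZ) (show _ ≤ t from ht) htm]
        unfold closureIdx
        refine Finset.mem_image_of_mem _ ?_
        have hcZ : zZ.1 ∈ zZ.2 := by rw [hZ]; exact hc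
        exact coarse_Qfrom_mem_orbit L s j hcZ (t - j)
      · exact Finset.empty_subset _
  | .renew G h, Z, hP, t, m, ht, htm => by
      obtain ⟨ZG, hG, hlt, -⟩ := hP
      simp only [PGen.lastStep] at ht
      unfold deadAnchors; rw [MDP_renew]
      exact deadAnchors_subset_closureIdx G ZG hG (by omega) htm
  | .join X Y sj, Z, hP, t, m, ht, htm => by
      obtain ⟨ZX, ZY, hX, hY, hXs, hYs, -⟩ := hP
      simp only [PGen.lastStep] at ht
      have h1 := deadAnchors_subset_closureIdx X ZX hX (show X.lastStep ≤ t by omega) htm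
      have h2 := deadAnchors_subset_closureIdx Y ZY hY (show Y.lastStep ≤ t by omega) htm
      rw [deadAnchors_join, MDP_join]
      unfold closureIdx at h1 h2 ⊢
      rw [Finset.image_union]
      exact Finset.union_subset_union h1 h2

/-- the footprint coefficient of the ledger at lag `i`: `v ↦ 2^d·(16·21^d·v∕2^i + 1)` [folklore] -/
theorem foot_nonneg (d i : ℕ) (v : ℕ) : (0 : ℝ) ≤ 2 ^ d * (16 * (21 ^ d * (v : ℝ)) / 2 ^ i + 1) := by positivity

/-- the single-component case of the lagged count: for `lastStep ≤ t` and `t + 1 ≤ m`, transport then decay (the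
maximal domain at `t` is non-empty and touch-connected, A3a). [folklore] -/
theorem single (hL : 4 ≤ L) (hdrop : ∀ m, DropCtl s m) {P : PGen (Pt d × Finset (Pt d))} {Z : Finset (Pt d)}
    (hP : RealisesW L s R P Z) {t m : ℕ} (ht : P.lastStep ≤ t) (htm : t + 1 ≤ m) :
    ((deadAnchors L s P m).card : ℝ) ≤
      compSum L s (fun v => 2 ^ d * (16 * (21 ^ d * (v : ℝ)) / 2 ^ (m - t) + 1)) P t + recent P t m := by
  have hsub := deadAnchors_subset_closureIdx P Z hP (t := t) (m := m) ht (by omega)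
  have hne := nonempty_touchConnected_MDP (show 1 ≤ L by omega) P Z hP ht
  have hdec := card_closureIdx_Qfrom_le_card hL hdrop hne.1 hne.2 t (i := m - t) (by omega)
  have h1 : ((deadAnchors L s P m).card : ℝ) ≤ (closureIdx (Qfrom L s t (m - t)) (MDP L s P t)).card := by
    exact_mod_cast Finset.card_le_card hsub
  rw [compSum_of_le P (adm_of_realisesW P Z hP le_rfl) ht]
  have h3 : (0 : ℝ) ≤ recent P t m := Nat.cast_nonneg _
  linarith

/-- **THE LAGGED COUNT OF THE DEAD ANCHORS.**  For a pedigree realised along a flow with `L ≥ 4` and drop control on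
every horizon, every `m` and every lag time `t` with `t + 1 ≤ m`:
`#deadAnchors P m ≤ Σ_{components x at t} 2^d·(16·21^d·#MDP_x(t)∕2^{m−t} + 1) + #{births in (t, m]}` — the anchors of
the births up to `t` lie in their components' footprints (transport, then A1's decay on each component, non-empty and
touch-connected by A3a), the later births contribute at most one anchor each. [folklore] -/
theorem card_deadAnchors_le (hL : 4 ≤ L) (hdrop : ∀ m, DropCtl s m) :
    ∀ (P : PGen (Pt d × Finset (Pt d))) (Z : Finset (Pt d)), RealisesW L s R P Z → ∀ {t m : ℕ}, t + 1 ≤ m →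
      ((deadAnchors L s P m).card : ℝ) ≤
        compSum L s (fun v => 2 ^ d * (16 * (21 ^ d * (v : ℝ)) / 2 ^ (m - t) + 1)) P t + recent P t m
  | .birth j cls zZ, Z, hP, t, m, htm => by
      by_cases hjt : j ≤ t
      · exact single hL hdrop hP hjt htm
      · -- born after `t`: at most one anchor, counted as recent (or none if not yet born)
        have h0 : compSum L s (fun v => 2 ^ d * (16 * (21 ^ d * (v : ℝ)) / 2 ^ (m - t) + 1)) (PGen.birth j cls zZ) t
            = 0 := by unfold compSum; rw [if_neg hjt]
        rw [h0, zero_add]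
        by_cases hjm : j ≤ m
        · have hr : recent (PGen.birth j cls zZ) t m = 1 := by
            unfold recent; rw [if_pos ⟨by omega, hjm⟩]
          have hd : (deadAnchors L s (PGen.birth j cls zZ) m).card ≤ 1 := by
            unfold deadAnchors; split_ifs <;> simp
          rw [hr]; exact_mod_cast hd
        · have hd : deadAnchors L s (PGen.birth j cls zZ) m = ∅ := by
            unfold deadAnchors; rw [if_neg (fun h => hjm h.1)]
          rw [hd]; simp
  | .renew G h, Z, hP, t, m, htm => by
      obtain ⟨ZG, hG, -⟩ := hP
      exact card_deadAnchors_le hL hdrop G ZG hG htm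
  | .join X Y sj, Z, hP, t, m, htm => by
      by_cases hst : sj ≤ t
      · exact single hL hdrop hP hst htm
      · -- the partners' families
        obtain ⟨ZX, ZY, hX, hY, -⟩ := hP
        have h1 := card_deadAnchors_le hL hdrop X ZX hX htm
        have h2 := card_deadAnchors_le hL hdrop Y ZY hY htm
        have h0 : compSum L s (fun v => 2 ^ d * (16 * (21 ^ d * (v : ℝ)) / 2 ^ (m - t) + 1)) (PGen.join X Y sj) t
            = compSum L s (fun v => 2 ^ d * (16 * (21 ^ d * (v : ℝ)) / 2 ^ (m - t) + 1)) X t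
              + compSum L s (fun v => 2 ^ d * (16 * (21 ^ d * (v : ℝ)) / 2 ^ (m - t) + 1)) Y t := by
          conv_lhs => unfold compSum
          rw [if_neg hst]
        have hu : ((deadAnchors L s (PGen.join X Y sj) m).card : ℝ) ≤
            (deadAnchors L s X m).card + (deadAnchors L s Y m).card := by
          rw [deadAnchors_join]; exact_mod_cast Finset.card_union_le _ _
        have hr : (recent (PGen.join X Y sj) t m : ℝ) = recent X t m + recent Y t m := by
          rw [recent_join]; push_cast; ring
        linarith

end Transport

/-! ## §4 The per-step inequality of the flat ledger along a pedigree -/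

section PerStep

variable {L : ℕ} {s R : ℕ → ℕ}

/-- the single-component case of the per-step inequality (`lastStep ≤ m`). [folklore] -/
theorem psingle (hL : 4 ≤ L) (hdrop : ∀ m, DropCtl s m) {P : PGen (Pt d × Finset (Pt d))} {Z : Finset (Pt d)}
    (hP : RealisesW L s R P Z) {t m : ℕ} (hm : P.lastStep ≤ m) (htm : t + 1 ≤ m) :
    compSum L s (fun v => (v : ℝ)) P m ≤ youngVol L s P m
      + 561 ^ d * (compSum L s (fun v => 2 ^ d * (16 * (21 ^ d * (v : ℝ)) / 2 ^ (m - t) + 1)) P t + recent P t m) := by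
  have h1 := card_MDP_le_young_add_dead (show 2 ≤ L by omega) hdrop hP m
  have h2 := card_deadAnchors_le hL hdrop P Z hP htm
  rw [compSum_of_le P (adm_of_realisesW P Z hP le_rfl) hm]
  have h5 : (0 : ℝ) ≤ 561 ^ d := by positivity
  nlinarith [mul_le_mul_of_nonneg_left h2 h5]

/-- **THE PER-STEP INEQUALITY** (ruling R-OWNER-43-1 (c)) for a pedigree realised along a flow with `L ≥ 4` and drop
control on every horizon, at every step `m` and lag time `t` with `t + 1 ≤ m`:
`V(m) ≤ Y(m) + 561^d·(Σ_{components x at t} 2^d·(16·21^d·V_x(t)∕2^{m−t} + 1) + #{births in (t, m]})`, with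
`V = compSum id`, `Y = youngVol` — the hypothesis of `HistoryBankingFlatLedger.flat_total_le` at the steps past the lag
(`c_A = 561^d`, `c_F = 1122^d`, `ε = 1122^d·16·21^d∕2^{m−t}` after distributing). [folklore] -/
theorem perStep (hL : 4 ≤ L) (hdrop : ∀ m, DropCtl s m) :
    ∀ (P : PGen (Pt d × Finset (Pt d))) (Z : Finset (Pt d)), RealisesW L s R P Z → ∀ {t m : ℕ}, t + 1 ≤ m →
      compSum L s (fun v => (v : ℝ)) P m ≤ youngVol L s P m
        + 561 ^ d * (compSum L s (fun v => 2 ^ d * (16 * (21 ^ d * (v : ℝ)) / 2 ^ (m - t) + 1)) P t + recent P t m)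
  | .birth j cls zZ, Z, hP, t, m, htm => by
      by_cases hjm : j ≤ m
      · exact psingle hL hdrop hP hjm htm
      · have h0 : compSum L s (fun v => (v : ℝ)) (PGen.birth j cls zZ) m = 0 := by unfold compSum; rw [if_neg hjm]
        rw [h0]
        have := youngVol_nonneg (L := L) (s := s) (PGen.birth j cls zZ) m
        have := compSum_nonneg (L := L) (s := s) (foot_nonneg d (m - t)) (PGen.birth j cls zZ) t
        positivity
  | .renew G h, Z, hP, t, m, htm => by
      obtain ⟨ZG, hG, -⟩ := hP
      exact perStep hL hdrop G ZG hG htm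
  | .join X Y sj, Z, hP, t, m, htm => by
      by_cases hsm : sj ≤ m
      · exact psingle hL hdrop hP hsm htm
      · obtain ⟨ZX, ZY, hX, hY, -⟩ := hP
        have h1 := perStep hL hdrop X ZX hX htm
        have h2 := perStep hL hdrop Y ZY hY htm
        have hst : ¬ sj ≤ t := fun h => hsm (by omega)
        have h0 : compSum L s (fun v => (v : ℝ)) (PGen.join X Y sj) m =
            compSum L s (fun v => (v : ℝ)) X m + compSum L s (fun v => (v : ℝ)) Y m := by
          conv_lhs => unfold compSum
          rw [if_neg hsm]
        have h0' : compSum L s (fun v => 2 ^ d * (16 * (21 ^ d * (v : ℝ)) / 2 ^ (m - t) + 1)) (PGen.join X Y sj) t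
            = compSum L s (fun v => 2 ^ d * (16 * (21 ^ d * (v : ℝ)) / 2 ^ (m - t) + 1)) X t
              + compSum L s (fun v => 2 ^ d * (16 * (21 ^ d * (v : ℝ)) / 2 ^ (m - t) + 1)) Y t := by
          conv_lhs => unfold compSum
          rw [if_neg hst]
        have hy : youngVol L s (PGen.join X Y sj) m = youngVol L s X m + youngVol L s Y m := youngVol_join _ _ _ _
        have hr : (recent (PGen.join X Y sj) t m : ℝ) = recent X t m + recent Y t m := by
          rw [recent_join]; push_cast; ring
        rw [h0, h0', hy, hr]
        linarith

end PerStep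

end

end Summit.QuantumFields.BalabanUV.T4Continuum.HistoryBankingPedigreeLedger
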